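import Mathlib
import Summits.AtomisticToContinuum.Crystallization.Theorems.ReggeStarCoercivityDefectFreeCrystallizesLayeredGluing
import HarnessLib

/-!
# Pinned gluing, part A: PINNED layered charts pass to the local limit — line `stacking-blind-budget-flatness`,
crux `ChessboardParticlePlanes.LjLaminarWindows` (stmt-AtomisticToContinuum-6711), stub `stub_pinnedGluing`

The stub `stub_pinnedGluing` (S3 of the line) is the pinned, centred twin of the PROVED gluing lemma
`PrestressSplitKorn.stub_layeredGluing : LayeredGluing` (crux 13603, files
`ReggeStarCoercivityDefectFreeCrystallizesLayeredGluing*.lean`).  "Pinned" means: the box template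
`layeredPos a s z` lies in the cone's box `InBox a z` AND all interlayer increments are `≥ 19/25`
(`∀ m, 19/25 ≤ z (m+1) - z m`).  The pinned predicates are written INLINE (explicit `∃`, no new definition).

This part is the passage to the limit (pinned twin of `SetLayeredNear.normal_form`, `template_extraction`,
`exactNear_of_limit` of the tower):

* `pinned_normal_form` — a pinned `η`-chart of the 2-ball of a point `q` of a set is re-based at `q`
  (label `0 ↦` a point `η`-close to `q + t`, `z 0 = 0`); re-basing `k ↦ z (k + m₀) - z m₀` keeps the increments.
* `pinned_template_extraction` — compactness of the template data; the closed condition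
  `19/25 ≤ z (m+1) - z m` passes to the pointwise limit.
* `pinned_exactNear_of_limit` — a local limit (local matching topology) of `δ`-separated sets whose points carry
  pinned `η_k`-charts (`η_k → 0`) on their 2-balls is EXACTLY a rigid image of a PINNED box template on every open
  2-ball.
* `pinned_setChart_of_particleChart` — the particle-indexed hypothesis of the stub, recentred, in set form.
-/

noncomputable section

open scoped BigOperators Classical InnerProductSpace
open Filter Topology

namespace Summit.AtomisticToContinuum.Crystallization.Theorems.StackingBlindBudgetFlatness

open Literature.MathematicalPhysics.StatisticalMechanics Literature.Geometry.DiscreteGeometry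
open Summit.AtomisticToContinuum.Crystallization.Theorems.PrestressSplitKorn

/-! ## Re-basing keeps the pinned increments -/

/-- Increments `≥ 19/25` are invariant under re-basing the heights at an index `m₀`:
`k ↦ z (k + m₀) - z m₀`. -/
theorem pinned_shift {z : ℤ → ℝ} (hz : ∀ m : ℤ, 19 / 25 ≤ z (m + 1) - z m) (m₀ m : ℤ) :
    19 / 25 ≤ (z (m + 1 + m₀) - z m₀) - (z (m + m₀) - z m₀) := by
  have h := hz (m + m₀)
  rw [show m + m₀ + 1 = m + 1 + m₀ by ring] at h
  linarith

/-- **Normal form of a pinned chart at a point of the set**: relabel so that `q + t` is `η`-close to the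
template ORIGIN (label `0`, `z 0 = 0`); the pinned increments are kept (pinned twin of
`SetLayeredNear.normal_form`). -/
theorem pinned_normal_form {η : ℝ} {Z : Set (EuclideanSpace ℝ (Fin 3))} {q : EuclideanSpace ℝ (Fin 3)}
    (h : ∃ (A : EuclideanSpace ℝ (Fin 3) →ₗᵢ[ℝ] EuclideanSpace ℝ (Fin 3)) (t : EuclideanSpace ℝ (Fin 3)) (a : ℝ)
        (s : ℤ → ℤ) (z : ℤ → ℝ), (InBox a z ∧ ∀ m : ℤ, 19 / 25 ≤ z (m + 1) - z m) ∧ IsHaggSeq s ∧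
      (∀ y ∈ Z, dist y q ≤ 2 → ∃ l, dist (y + t) (A (layeredPos a s z l)) ≤ η) ∧
      (∀ l, dist (A (layeredPos a s z l)) (q + t) ≤ 2 → ∃ y ∈ Z, dist (y + t) (A (layeredPos a s z l)) ≤ η))
    (hq : q ∈ Z) :
    ∃ (A : EuclideanSpace ℝ (Fin 3) →ₗᵢ[ℝ] EuclideanSpace ℝ (Fin 3)) (t : EuclideanSpace ℝ (Fin 3)) (a : ℝ)
        (s : ℤ → ℤ) (z : ℤ → ℝ), (InBox a z ∧ ∀ m : ℤ, 19 / 25 ≤ z (m + 1) - z m) ∧ IsHaggSeq s ∧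
      z 0 = 0 ∧ ‖q + t‖ ≤ η ∧
      (∀ y ∈ Z, dist y q ≤ 2 → ∃ l, dist (y + t) (A (layeredPos a s z l)) ≤ η) ∧
      (∀ l, dist (A (layeredPos a s z l)) (q + t) ≤ 2 → ∃ y ∈ Z, dist (y + t) (A (layeredPos a s z l)) ≤ η) := by
  obtain ⟨A, t, a, s, z, ⟨hbox, hpin⟩, hs, h1, h2⟩ := h
  obtain ⟨l₀, hl₀⟩ := h1 q hq (by simp)
  set s' : ℤ → ℤ := fun k => s (k + l₀.1) with hs'
  set z' : ℤ → ℝ := fun k => z (k + l₀.1) - z l₀.1 with hz'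
  set p₀ := A (layeredPos a s z l₀) with hp₀
  have key : ∀ l, A (layeredPos a s' z' l) = A (layeredPos a s z (l + l₀)) - p₀ := fun l => by
    rw [hs', hz', layeredPos_shift, map_sub]
  refine ⟨A, t - p₀, a, s', z', ⟨hbox.shift _, fun m => ?_⟩, isHaggSeq_shift hs _, by simp [hz'], ?_, ?_, ?_⟩
  · simp only [hz']
    exact pinned_shift hpin _ _
  · rw [← add_sub_assoc, ← dist_eq_norm]; exact hl₀
  · intro y hy hyq
    obtain ⟨l, hl⟩ := h1 y hy hyq
    refine ⟨l - l₀, ?_⟩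
    rwa [key, sub_add_cancel, ← add_sub_assoc, dist_sub_right]
  · intro l hl
    rw [key] at hl ⊢
    rw [← add_sub_assoc, dist_sub_right] at hl
    obtain ⟨y, hy, hyl⟩ := h2 (l + l₀) hl
    exact ⟨y, hy, by rwa [← add_sub_assoc, dist_sub_right]⟩

/-! ## Extraction of a pinned limit template -/

/-- **Extraction of a PINNED limit template**: `template_extraction` (isometries, translations, spacings, words
and based heights range in a compact product) plus the closed condition `19/25 ≤ z (m+1) - z m`, which passes
to the pointwise limit of the heights. -/
theorem pinned_template_extraction (A : ℕ → (EuclideanSpace ℝ (Fin 3) →ₗᵢ[ℝ] EuclideanSpace ℝ (Fin 3)))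
    (t : ℕ → EuclideanSpace ℝ (Fin 3)) (a : ℕ → ℝ) (s : ℕ → ℤ → ℤ) (z : ℕ → ℤ → ℝ) {C : ℝ}
    (h : ∀ᶠ k in atTop, (InBox (a k) (z k) ∧ ∀ m : ℤ, 19 / 25 ≤ z k (m + 1) - z k m) ∧
      IsHaggSeq (s k) ∧ z k 0 = 0 ∧ ‖t k‖ ≤ C) :
    ∃ (ψ : ℕ → ℕ) (A' : EuclideanSpace ℝ (Fin 3) →ₗᵢ[ℝ] EuclideanSpace ℝ (Fin 3)) (t' : EuclideanSpace ℝ (Fin 3))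
        (a' : ℝ) (s' : ℤ → ℤ) (z' : ℤ → ℝ), StrictMono ψ ∧
      (InBox a' z' ∧ ∀ m : ℤ, 19 / 25 ≤ z' (m + 1) - z' m) ∧ IsHaggSeq s' ∧ z' 0 = 0 ∧
      (∀ v, Tendsto (fun k => A (ψ k) v) atTop (𝓝 (A' v))) ∧
      Tendsto (fun k => t (ψ k)) atTop (𝓝 t') ∧
      Tendsto (fun k => a (ψ k)) atTop (𝓝 a') ∧
      (∀ m, ∀ᶠ k in atTop, s (ψ k) m = s' m) ∧
      (∀ m, Tendsto (fun k => z (ψ k) m) atTop (𝓝 (z' m))) := by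
  have h' : ∀ᶠ k in atTop, InBox (a k) (z k) ∧ IsHaggSeq (s k) ∧ z k 0 = 0 ∧ ‖t k‖ ≤ C :=
    h.mono fun k hk => ⟨hk.1.1, hk.2⟩
  obtain ⟨ψ, A', t', a', s', z', hψ, hbox', hs', hz0', hA', ht', ha', hs'ev, hz'⟩ :=
    template_extraction A t a s z h'
  refine ⟨ψ, A', t', a', s', z', hψ, ⟨hbox', fun m => ?_⟩, hs', hz0', hA', ht', ha', hs'ev, hz'⟩
  have hψev := hψ.tendsto_atTop.eventually h
  exact ge_of_tendsto ((hz' (m + 1)).sub (hz' m)) (hψev.mono fun k hk => hk.1.2 m)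

/-! ## The local limit is exactly and pinnedly layered -/

/-- **The limit set is EXACTLY a rigid image of a PINNED box template on every open 2-ball** (pinned twin of
`exactNear_of_limit`): `Z k → Y` in the local matching topology, all sets `δ`-separated, the points of `Z k` of
norm `≤ r k → ∞` carry pinned `η k`-charts of their 2-balls, `η k → 0`. -/
theorem pinned_exactNear_of_limit {δ : ℝ} (hδ : 0 < δ) {Z : ℕ → Set (EuclideanSpace ℝ (Fin 3))}
    {Y : Set (EuclideanSpace ℝ (Fin 3))} (hY : ∀ p ∈ Y, ∀ q ∈ Y, p ≠ q → δ ≤ dist p q)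
    (hmatch : ∀ ρ γ : ℝ, 0 < γ → ∀ᶠ k in atTop, BallMatch γ ρ 0 (Z k) Y)
    {η r : ℕ → ℝ} (hη : Tendsto η atTop (𝓝 0)) (hr : Tendsto r atTop atTop)
    (hloc : ∀ k, ∀ q ∈ Z k, ‖q‖ ≤ r k →
      ∃ (A : EuclideanSpace ℝ (Fin 3) →ₗᵢ[ℝ] EuclideanSpace ℝ (Fin 3)) (t : EuclideanSpace ℝ (Fin 3)) (a : ℝ)
          (s : ℤ → ℤ) (z : ℤ → ℝ), (InBox a z ∧ ∀ m : ℤ, 19 / 25 ≤ z (m + 1) - z m) ∧ IsHaggSeq s ∧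
        (∀ y ∈ Z k, dist y q ≤ 2 → ∃ l, dist (y + t) (A (layeredPos a s z l)) ≤ η k) ∧
        (∀ l, dist (A (layeredPos a s z l)) (q + t) ≤ 2 →
          ∃ y ∈ Z k, dist (y + t) (A (layeredPos a s z l)) ≤ η k))
    {p : EuclideanSpace ℝ (Fin 3)} (hp : p ∈ Y) :
    ∃ (A : EuclideanSpace ℝ (Fin 3) →ₗᵢ[ℝ] EuclideanSpace ℝ (Fin 3)) (t : EuclideanSpace ℝ (Fin 3)) (a : ℝ)
        (s : ℤ → ℤ) (z : ℤ → ℝ), (InBox a z ∧ ∀ m : ℤ, 19 / 25 ≤ z (m + 1) - z m) ∧ IsHaggSeq s ∧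
      (∀ y ∈ Y, dist y p < 2 → ∃ l, y + t = A (layeredPos a s z l)) ∧
      (∀ l, dist (A (layeredPos a s z l)) (p + t) < 2 → A (layeredPos a s z l) - t ∈ Y) := by
  have hfin : ∀ w : EuclideanSpace ℝ (Fin 3), (Y ∩ Metric.closedBall w 1).Finite := fun w =>
    finite_of_forall_le_dist_of_subset_closedBall hδ (fun p hp q hq => hY p hp.1 q hq.1)
      Set.inter_subset_right
  -- (1) approximants of `p`
  obtain ⟨q, hqZ, hqp⟩ := exists_seq_tendsto hmatch hp
  -- (2) normalized pinned template data at `q k`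
  have hgood : ∀ᶠ k in atTop,
      ∃ (A : EuclideanSpace ℝ (Fin 3) →ₗᵢ[ℝ] EuclideanSpace ℝ (Fin 3)) (t : EuclideanSpace ℝ (Fin 3)) (a : ℝ)
          (s : ℤ → ℤ) (z : ℤ → ℝ), (InBox a z ∧ ∀ m : ℤ, 19 / 25 ≤ z (m + 1) - z m) ∧ IsHaggSeq s ∧
        (∀ y ∈ Z k, dist y (q k) ≤ 2 → ∃ l, dist (y + t) (A (layeredPos a s z l)) ≤ η k) ∧
        (∀ l, dist (A (layeredPos a s z l)) (q k + t) ≤ 2 →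
          ∃ y ∈ Z k, dist (y + t) (A (layeredPos a s z l)) ≤ η k) := by
    have h1 : ∀ᶠ k in atTop, ‖q k‖ < ‖p‖ + 1 :=
      hqp.norm.eventually (gt_mem_nhds (by linarith [norm_nonneg p]))
    have h2 : ∀ᶠ k in atTop, ‖p‖ + 1 ≤ r k := hr.eventually_ge_atTop _
    filter_upwards [hqZ, h1, h2] with k hk hk1 hk2 using hloc k (q k) hk (by linarith)
  have hdata : ∀ k, ∃ (A : EuclideanSpace ℝ (Fin 3) →ₗᵢ[ℝ] EuclideanSpace ℝ (Fin 3)) (t : EuclideanSpace ℝ (Fin 3))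
      (a : ℝ) (s : ℤ → ℤ) (z : ℤ → ℝ),
      (q k ∈ Z k ∧
        ∃ (A : EuclideanSpace ℝ (Fin 3) →ₗᵢ[ℝ] EuclideanSpace ℝ (Fin 3)) (t : EuclideanSpace ℝ (Fin 3)) (a : ℝ)
            (s : ℤ → ℤ) (z : ℤ → ℝ), (InBox a z ∧ ∀ m : ℤ, 19 / 25 ≤ z (m + 1) - z m) ∧ IsHaggSeq s ∧
          (∀ y ∈ Z k, dist y (q k) ≤ 2 → ∃ l, dist (y + t) (A (layeredPos a s z l)) ≤ η k) ∧
          (∀ l, dist (A (layeredPos a s z l)) (q k + t) ≤ 2 →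
            ∃ y ∈ Z k, dist (y + t) (A (layeredPos a s z l)) ≤ η k)) →
        (InBox a z ∧ ∀ m : ℤ, 19 / 25 ≤ z (m + 1) - z m) ∧ IsHaggSeq s ∧ z 0 = 0 ∧ ‖q k + t‖ ≤ η k ∧
        (∀ y ∈ Z k, dist y (q k) ≤ 2 → ∃ l, dist (y + t) (A (layeredPos a s z l)) ≤ η k) ∧
        (∀ l, dist (A (layeredPos a s z l)) (q k + t) ≤ 2 →
          ∃ y ∈ Z k, dist (y + t) (A (layeredPos a s z l)) ≤ η k) := by
    intro k
    by_cases hk : q k ∈ Z k ∧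
        ∃ (A : EuclideanSpace ℝ (Fin 3) →ₗᵢ[ℝ] EuclideanSpace ℝ (Fin 3)) (t : EuclideanSpace ℝ (Fin 3)) (a : ℝ)
            (s : ℤ → ℤ) (z : ℤ → ℝ), (InBox a z ∧ ∀ m : ℤ, 19 / 25 ≤ z (m + 1) - z m) ∧ IsHaggSeq s ∧
          (∀ y ∈ Z k, dist y (q k) ≤ 2 → ∃ l, dist (y + t) (A (layeredPos a s z l)) ≤ η k) ∧
          (∀ l, dist (A (layeredPos a s z l)) (q k + t) ≤ 2 →
            ∃ y ∈ Z k, dist (y + t) (A (layeredPos a s z l)) ≤ η k)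
    · obtain ⟨A, t, a, s, z, h⟩ := pinned_normal_form hk.2 hk.1
      exact ⟨A, t, a, s, z, fun _ => h⟩
    · exact ⟨LinearIsometry.id, 0, 1, fun _ => 1, fun m => m, fun h => absurd h hk⟩
  choose A t a s z hAt using hdata
  have hev : ∀ᶠ k in atTop, (InBox (a k) (z k) ∧ ∀ m : ℤ, 19 / 25 ≤ z k (m + 1) - z k m) ∧
      IsHaggSeq (s k) ∧ z k 0 = 0 ∧ ‖q k + t k‖ ≤ η k ∧
      (∀ y ∈ Z k, dist y (q k) ≤ 2 → ∃ l, dist (y + t k) (A k (layeredPos (a k) (s k) (z k) l)) ≤ η k) ∧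
      (∀ l, dist (A k (layeredPos (a k) (s k) (z k) l)) (q k + t k) ≤ 2 →
        ∃ y ∈ Z k, dist (y + t k) (A k (layeredPos (a k) (s k) (z k) l)) ≤ η k) := by
    filter_upwards [hqZ, hgood] with k h1 h2 using hAt k ⟨h1, h2⟩
  -- (3) bounds
  have hη1 : ∀ᶠ k in atTop, η k ≤ 1 := hη.eventually (ge_mem_nhds one_pos)
  have hqp1 : ∀ᶠ k in atTop, dist (q k) p ≤ 1 :=
    ((tendsto_iff_dist_tendsto_zero.1 hqp).eventually (ge_mem_nhds one_pos))
  have hbd : ∀ᶠ k in atTop, (InBox (a k) (z k) ∧ ∀ m : ℤ, 19 / 25 ≤ z k (m + 1) - z k m) ∧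
      IsHaggSeq (s k) ∧ z k 0 = 0 ∧ ‖t k‖ ≤ ‖p‖ + 2 := by
    filter_upwards [hev, hη1, hqp1] with k hk h1 h2
    refine ⟨hk.1, hk.2.1, hk.2.2.1, ?_⟩
    have hq1 : ‖q k‖ ≤ ‖p‖ + 1 := by
      calc ‖q k‖ = ‖(q k - p) + p‖ := by rw [sub_add_cancel]
        _ ≤ ‖q k - p‖ + ‖p‖ := norm_add_le _ _
        _ ≤ 1 + ‖p‖ := by rw [← dist_eq_norm]; linarith
        _ = ‖p‖ + 1 := by ring
    calc ‖t k‖ = ‖(q k + t k) - q k‖ := by rw [add_sub_cancel_left]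
      _ ≤ ‖q k + t k‖ + ‖q k‖ := norm_sub_le _ _
      _ ≤ ‖p‖ + 2 := by linarith [hk.2.2.2.1]
  -- (4) extraction
  obtain ⟨ψ, A', t', a', s', z', hψ, hbox', hs', -, hA', ht', ha', hs'ev, hz'⟩ :=
    pinned_template_extraction A t a s z hbd
  have hψt : Tendsto ψ atTop atTop := hψ.tendsto_atTop
  have hevψ := hψt.eventually hev
  have hbdψ := hψt.eventually hbd
  have hqψ : Tendsto (fun k => q (ψ k)) atTop (𝓝 p) := hqp.comp hψt
  have hηψ : Tendsto (fun k => η (ψ k)) atTop (𝓝 0) := hη.comp hψt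
  have hη1ψ : ∀ᶠ k in atTop, η (ψ k) ≤ 1 := hψt.eventually hη1
  have hmatchψ : ∀ ρ γ : ℝ, 0 < γ → ∀ᶠ k in atTop, BallMatch γ ρ 0 (Z (ψ k)) Y :=
    fun ρ γ hγ => hψt.eventually (hmatch ρ γ hγ)
  have hTP : ∀ l, Tendsto (fun k => A (ψ k) (layeredPos (a (ψ k)) (s (ψ k)) (z (ψ k)) l)) atTop
      (𝓝 (A' (layeredPos a' s' z' l))) :=
    fun l => tendsto_isometry_apply hA' (tendsto_layeredPos ha' hs'ev hz' l)
  refine ⟨A', t', a', s', z', hbox', hs', ?_, ?_⟩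
  · -- clause 1: points of `Y` in the open 2-ball are template points
    intro y hy hyp
    obtain ⟨u, huZ, huy⟩ := exists_seq_tendsto hmatch hy
    have huψ : Tendsto (fun k => u (ψ k)) atTop (𝓝 y) := huy.comp hψt
    have huZψ : ∀ᶠ k in atTop, u (ψ k) ∈ Z (ψ k) := hψt.eventually huZ
    have h2 : ∀ᶠ k in atTop, dist (u (ψ k)) (q (ψ k)) ≤ 2 :=
      ((huψ.dist hqψ).eventually (Iio_mem_nhds hyp)).mono fun k hk => le_of_lt hk
    have hu1 : ∀ᶠ k in atTop, ‖u (ψ k)‖ < ‖y‖ + 1 :=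
      huψ.norm.eventually (gt_mem_nhds (by linarith [norm_nonneg y]))
    set C : ℝ := ‖y‖ + ‖p‖ + 4 with hC
    set B : ℤ := ⌈4 * C⌉ with hB
    set F : Finset (ℤ × ℤ × ℤ) := (Finset.Icc (-B) B) ×ˢ ((Finset.Icc (-B) B) ×ˢ (Finset.Icc (-B) B))
      with hF
    have hIcc : ∀ n : ℤ, |(n : ℝ)| ≤ 4 * C → n ∈ Finset.Icc (-B) B := fun n hn => by
      rw [Finset.mem_Icc]
      obtain ⟨h1, h2⟩ := abs_le.1 hn
      have hB' : 4 * C ≤ (B : ℝ) := Int.le_ceil _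
      constructor
      · have : (-B : ℝ) ≤ n := by linarith
        exact_mod_cast this
      · have : (n : ℝ) ≤ B := by linarith
        exact_mod_cast this
    have hFev : ∀ᶠ k in atTop, ∃ l ∈ F,
        dist (u (ψ k) + t (ψ k)) (A (ψ k) (layeredPos (a (ψ k)) (s (ψ k)) (z (ψ k)) l)) ≤ η (ψ k) := by
      filter_upwards [hevψ, huZψ, h2, hu1, hη1ψ, hbdψ] with k hk hu h2 hu1 hη1 hbd
      obtain ⟨l, hl⟩ := hk.2.2.2.2.1 _ hu h2
      refine ⟨l, ?_, hl⟩
      have hnorm : ‖layeredPos (a (ψ k)) (s (ψ k)) (z (ψ k)) l‖ ≤ C := by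
        rw [← (A (ψ k)).norm_map]
        calc ‖A (ψ k) (layeredPos (a (ψ k)) (s (ψ k)) (z (ψ k)) l)‖
            = ‖(u (ψ k) + t (ψ k)) -
                ((u (ψ k) + t (ψ k)) - A (ψ k) (layeredPos (a (ψ k)) (s (ψ k)) (z (ψ k)) l))‖ := by
              rw [sub_sub_cancel]
          _ ≤ ‖u (ψ k) + t (ψ k)‖ +
              dist (u (ψ k) + t (ψ k)) (A (ψ k) (layeredPos (a (ψ k)) (s (ψ k)) (z (ψ k)) l)) := by
              rw [dist_eq_norm]
              exact norm_sub_le _ _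
          _ ≤ (‖u (ψ k)‖ + ‖t (ψ k)‖) + η (ψ k) := add_le_add (norm_add_le _ _) hl
          _ ≤ C := by rw [hC]; linarith [hbd.2.2.2]
      obtain ⟨hm, hi, hj⟩ := label_bound hbd.1.1 hbd.2.1 hbd.2.2.1 l hnorm
      simp only [hF, Finset.mem_product]
      exact ⟨hIcc _ hm, hIcc _ hi, hIcc _ hj⟩
    obtain ⟨l, -, hl⟩ := exists_frequently_of_frequently_exists F hFev.frequently
    refine ⟨l, ?_⟩
    have hD := le_zero_of_frequently_le ((huψ.add ht').dist (hTP l)) hηψ hl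
    exact dist_le_zero.1 hD
  · -- clause 2: template points in the open 2-ball are points of `Y`
    intro l hl
    set w : EuclideanSpace ℝ (Fin 3) := A' (layeredPos a' s' z' l) with hw_def
    have hw := hTP l
    have h2 : ∀ᶠ k in atTop,
        dist (A (ψ k) (layeredPos (a (ψ k)) (s (ψ k)) (z (ψ k)) l)) (q (ψ k) + t (ψ k)) ≤ 2 :=
      ((hw.dist (hqψ.add ht')).eventually (Iio_mem_nhds hl)).mono fun k hk => hk.le
    have hC2 : ∀ᶠ k in atTop, ∃ y ∈ Z (ψ k),
        dist (y + t (ψ k)) (A (ψ k) (layeredPos (a (ψ k)) (s (ψ k)) (z (ψ k)) l)) ≤ η (ψ k) := by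
      filter_upwards [hevψ, h2] with k hk h2 using hk.2.2.2.2.2 l h2
    apply mem_of_forall_exists_dist_le (hfin _)
    intro γ hγ
    have hsmall : ∀ᶠ k in atTop, ∀ y',
        dist (y' + t (ψ k)) (A (ψ k) (layeredPos (a (ψ k)) (s (ψ k)) (z (ψ k)) l)) ≤ η (ψ k) →
          dist y' (w - t') < γ / 2 := by
      have hlim : Tendsto (fun k => η (ψ k) +
          dist (A (ψ k) (layeredPos (a (ψ k)) (s (ψ k)) (z (ψ k)) l) - t (ψ k)) (w - t')) atTop (𝓝 0) := by
        have := hηψ.add (tendsto_iff_dist_tendsto_zero.1 (hw.sub ht'))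
        rwa [add_zero] at this
      filter_upwards [hlim.eventually (gt_mem_nhds (half_pos hγ))] with k hk y' hy'
      calc dist y' (w - t')
          ≤ dist y' (A (ψ k) (layeredPos (a (ψ k)) (s (ψ k)) (z (ψ k)) l) - t (ψ k)) +
            dist (A (ψ k) (layeredPos (a (ψ k)) (s (ψ k)) (z (ψ k)) l) - t (ψ k)) (w - t') :=
            dist_triangle _ _ _
        _ = dist (y' + t (ψ k)) (A (ψ k) (layeredPos (a (ψ k)) (s (ψ k)) (z (ψ k)) l)) +
            dist (A (ψ k) (layeredPos (a (ψ k)) (s (ψ k)) (z (ψ k)) l) - t (ψ k)) (w - t') := by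
            congr 1
            rw [dist_eq_norm, dist_eq_norm]; congr 1; abel
        _ ≤ _ := add_le_add_left hy' _
        _ < γ / 2 := hk
    obtain ⟨k, ⟨y', hy'Z, hy'⟩, hsm, hm⟩ :=
      (hC2.and (hsmall.and (hmatchψ (‖w - t'‖ + γ) (γ / 2) (half_pos hγ)))).exists
    have hd := hsm y' hy'
    obtain ⟨y'', hy''Y, hd''⟩ := hm.2 y' hy'Z (by
      rw [dist_zero_right]
      calc ‖y'‖ = ‖(y' - (w - t')) + (w - t')‖ := by rw [sub_add_cancel]
        _ ≤ ‖y' - (w - t')‖ + ‖w - t'‖ := norm_add_le _ _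
        _ ≤ ‖w - t'‖ + γ := by rw [← dist_eq_norm]; linarith)
    refine ⟨y'', hy''Y, ?_⟩
    calc dist y'' (w - t') ≤ dist y' y'' + dist y' (w - t') := dist_triangle_left _ _ _
      _ ≤ γ / 2 + γ / 2 := add_le_add hd'' hd.le
      _ = γ := by ring

/-! ## From the particle-indexed hypothesis to the set form (recentred) -/

/-- The pinned `η`-chart of the 2-ball of particle `j` (hypothesis format of `stub_pinnedGluing`), recentred at
particle `i`, is a pinned `η`-chart of the 2-ball of the point `x j - x i` of the recentred particle set
(pinned twin of `setLayeredNear_of_layeredNear`). -/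
theorem pinned_setChart_of_particleChart {N : ℕ} {η : ℝ} {x : Fin N → EuclideanSpace ℝ (Fin 3)} {i j : Fin N}
    (h : ∃ (A : EuclideanSpace ℝ (Fin 3) →ₗᵢ[ℝ] EuclideanSpace ℝ (Fin 3)) (t : EuclideanSpace ℝ (Fin 3)) (a : ℝ)
        (s : ℤ → ℤ) (z : ℤ → ℝ), (InBox a z ∧ ∀ m : ℤ, 19 / 25 ≤ z (m + 1) - z m) ∧ IsHaggSeq s ∧
      (∀ k : Fin N, dist (x k) (x j) ≤ 2 → ∃ l : ℤ × ℤ × ℤ, dist (x k + t) (A (layeredPos a s z l)) ≤ η) ∧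
      (∀ l : ℤ × ℤ × ℤ, dist (A (layeredPos a s z l)) (x j + t) ≤ 2 →
        ∃ k : Fin N, dist (x k + t) (A (layeredPos a s z l)) ≤ η)) :
    ∃ (A : EuclideanSpace ℝ (Fin 3) →ₗᵢ[ℝ] EuclideanSpace ℝ (Fin 3)) (t : EuclideanSpace ℝ (Fin 3)) (a : ℝ)
        (s : ℤ → ℤ) (z : ℤ → ℝ), (InBox a z ∧ ∀ m : ℤ, 19 / 25 ≤ z (m + 1) - z m) ∧ IsHaggSeq s ∧
      (∀ y ∈ Set.range (fun k => x k - x i), dist y (x j - x i) ≤ 2 →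
        ∃ l, dist (y + t) (A (layeredPos a s z l)) ≤ η) ∧
      (∀ l, dist (A (layeredPos a s z l)) (x j - x i + t) ≤ 2 →
        ∃ y ∈ Set.range (fun k => x k - x i), dist (y + t) (A (layeredPos a s z l)) ≤ η) := by
  obtain ⟨A, t, a, s, z, hbox, hs, h1, h2⟩ := h
  refine ⟨A, t + x i, a, s, z, hbox, hs, ?_, ?_⟩
  · rintro _ ⟨k, rfl⟩ hk
    rw [dist_sub_right] at hk
    obtain ⟨l, hl⟩ := h1 k hk
    exact ⟨l, by rwa [sub_add_add_cancel]⟩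
  · intro l hl
    rw [sub_add_add_cancel] at hl
    obtain ⟨k, hk⟩ := h2 l hl
    exact ⟨_, ⟨k, rfl⟩, by rwa [sub_add_add_cancel]⟩

/-- Landing anchor of this file (registered sub-goal of crux stmt-AtomisticToContinuum-6711, line
`stacking-blind-budget-flatness`, stub `stub_pinnedGluing`, part A; re-exports `pinned_shift`): increments
`≥ 19/25` are invariant under re-basing the heights. -/
theorem pinnedGluingA_anchor :
    ∀ z : ℤ → ℝ, (∀ m : ℤ, 19 / 25 ≤ z (m + 1) - z m) → ∀ m₀ m : ℤ, (19 : ℝ) / 25 ≤ (z (m + 1 + m₀) - z m₀) - (z (m + m₀) - z m₀) :=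
  fun _ hz m₀ m => pinned_shift hz m₀ m

end Summit.AtomisticToContinuum.Crystallization.Theorems.StackingBlindBudgetFlatness

end
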